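import Mathlib.Tactic.Linarith
import Mathlib.Tactic.NormNum
import Mathlib.Tactic.Ring
import HarnessLib

/-!
# The (0,1) cell of the ι-window, XXIV-B: the product ground `B₁ × B₂`, XI (ADDENDUM 1) — the degenerate rays and the two wall bottoms,
# uniformly (report [XXIV] §13): arithmetic shadows

Family `hodge`, b2b cell `hweil` (helper of item stmt-HodgeConjecture-2524). Companion (`pg11a_*`) of
`WeilTypeLadderH2ProductGroundEleven.lean` (same seat; kept separate because Theorems files are capped at 400 lines). Report
`run/shared/lean/b2b/hodge-weil/b2b-hweil-pv1-g36/H2-ZERO-ONE-24.md` ([XXIV]) §13 (ADDENDUM 1). HONEST FRAMING: census results inside the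
ladder's H2 test ((0,1) cell) on the SPECIAL fourfold `X₀ = B₁ × B₂`; nothing here is a rung; no case of the Hodge conjecture is proved; no
statement of [Markman 2025] / [Perry 2026] / [EdGFS 2025] is used. Conventions as in the companion (classes `(r,c,s)`, Mukai pairing
`2cc' − rs' − r's`, linear forms `(β,δ)`, `[λ²]`, `[2λλ′]`, frames, `A = (2 3; 1 2)`).
-/

-- mandated namespace `Summit.HodgeConjecture.HodgeConjecture.…` (Problem = Summit) trips `linter.dupNamespace`; the lakefile disables it
-- tree-wide (weak option), restated here so stand-alone elaboration is warning-free too.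
set_option linter.dupNamespace false

namespace Summit.HodgeConjecture.HodgeConjecture.WeilTypeLadder

section ProductGroundElevenAdd1

/-!
### ADDENDUM 1 ([XXIV] §13): the degenerate rays and the two wall bottoms, uniformly

* `pg11a_degenerate_rays` — the rays over the degenerate bottoms `(−1,1)` (type I frame `((1,d),(0,1))`, `u₁ = k(x)`) and
  `(1,1)` (type II frame `((0,1),(1,d))`, `u₀ = k(x)`): for the `j`-th member, `A^j = (p q; p′ q′)` with positive entries, the
  Euler characteristics that make it EMPTY are `χ(V, Q₂^{(j)}) = χ(u₀, w₂^{(j)}) = 2q(q+2q′)` (I) and `3χ(u₁, w₂^{(j)}) = 6p′(2p+3p′)`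
  (II) — `42, 624` at `j = 1, 2` and `≥ 42` whenever the entries are `≥ 1` with `q ≥ 3, q′ ≥ 2` resp. `p ≥ 2, p′ ≥ 1` (the entries of
  `A^j`, `j ≥ 1`, dominate those of `A`) —, and the window facts used: the root slope of `pλ₀ + qλ₁` exceeds that of `λ₀ = (1,d)`
  (`(pd+q)·1 > d·p`, I) resp. that of `λ₁ = (1,d)` (`q·d + p > d·q`... cleared: `p > 0`, II).
* `pg11a_wall_bottoms` — the two wall bottoms as instances of template 𝒞₁: `(b₀,b₁) = (3,1)` (type I, `D(3,0)`, frame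
  `((3,−1),(1,0))`): `u_q = (4,−2,1)` (`Ŝ₂`), `𝔄 = n − 4u₁ = (2,−1,0)` (`U₃^∨`), slopes `μ(q) = μ(R)` (the boundary of `pg11_uq`'s
  inequality: `(b₀−b₁)(3b₁−b₀) = 0`), `μ(q) < μ(u₀)` (`−(b₀−b₁)b₀ = −6`), `μ(𝔄) < μ(u₀)` (`b₀(b₀−4b₁) = −3`), bounds `χ(q,w₂) = 6`,
  `−χ(𝔄,w₁) = 4`; `(b₀,b₁) = (1,1)` (type II, `(1,2)`, frame `((1,1),(1,0))`): `u_q = (0,0,1)` (a POINT: `q = k(x)`), `𝔄 = 4u₁ − n =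
  (2,−1,0)` (the 'unit class' `U` of T2/R2C up to dual), `w₂ = (10,2,0)`, `w₁ = (6,4,2)`, bounds `χ(𝔄,w₂) = 4`, `χ(q,w₁) = 6 = rk w₁`,
  slopes `μ(𝔄) = −1 < μ(w₂) = 2/5`, `μ(𝔄) < μ(w₁) = 4/3`.
-/

/-- **The degenerate rays are EMPTY at every height ([XXIV] ADDENDUM 1, LEMMA DR).** In the degenerate type-I frame `λ₀ = (1,d)`,
`λ₁ = (0,1)` (`u₀ = (1,d,d²)`, `u₁ = (0,0,1)`, `n = (0,1,2d)`, det `= 1`) the `j`-th ray member's B₂ class is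
`w₂^{(j)} = 2[λλ′]`, `λ = pλ₀ + qλ₁ = (p, pd+q)`, `λ′ = λ + 2λ₁^{(j)} = (p+2p′)λ₀ + (q+2q′)λ₁`, and `χ(u₀, w₂^{(j)}) = −⟨u₀, w₂^{(j)}⟩ =
2q(q+2q′)`; in the degenerate type-II frame `λ₀ = (0,1)`, `λ₁ = (1,d)` (det `= −1`) with `w₂^{(j)} = 2[λ₁^{(j)}(2λ₀^{(j)}+3λ₁^{(j)})]`,
`λ₁^{(j)} = p′λ₀ + q′λ₁`, one has `3χ(u₁, w₂^{(j)}) = 6p′(2p+3p′)`. Values `42, 624` at `A, A²`; lower bound `42` for entries at least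
those of `A`; and the window inequalities `(pd+q)·1 − d·p = q > 0` (I: every combination with `q > 0` has root slope above `λ₀`'s)
and `(p + qd) − d·q = p > 0` (II). [shadow of ORB (iv) in the degenerate frames; `ring` / `norm_num` / `nlinarith`] -/
theorem pg11a_degenerate_rays :
    (∀ d p q p' q' : ℤ,
      -(2 * d * ((p * (p * d + q + 2 * (p' * d + q')) + (p + 2 * p') * (p * d + q)))
          - 1 * (2 * (p * d + q) * (p * d + q + 2 * (p' * d + q'))) - (2 * p * (p + 2 * p')) * d ^ 2)
        = 2 * q * (q + 2 * q') * (1 * 1 - 0 * d) ^ 2) ∧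
    (∀ d p q p' q' : ℤ,
      -3 * (2 * d * ((q') * ((2 * p + 3 * p') + (2 * q + 3 * q') * d) + (2 * q + 3 * q') * (p' + q' * d))
          - 1 * (2 * (p' + q' * d) * ((2 * p + 3 * p') + (2 * q + 3 * q') * d)) - (2 * q' * (2 * q + 3 * q')) * d ^ 2)
        = 6 * p' * (2 * p + 3 * p') * (0 * d - 1 * 1) ^ 2) ∧
    (2 * 3 * (3 + 2 * 2) = (42:ℤ) ∧ 2 * 12 * (12 + 2 * 7) = (624:ℤ) ∧ 6 * 1 * (2 * 2 + 3 * 1) = (42:ℤ) ∧ 6 * 4 * (2 * 7 + 3 * 4) = (624:ℤ)) ∧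
    (∀ q q' : ℤ, 3 ≤ q → 2 ≤ q' → 42 ≤ 2 * q * (q + 2 * q')) ∧
    (∀ p p' : ℤ, 2 ≤ p → 1 ≤ p' → 42 ≤ 6 * p' * (2 * p + 3 * p')) ∧
    (∀ d p q : ℤ, (p * d + q) * 1 - d * p = q ∧ (p + q * d) - d * q = p) := by
  refine ⟨fun d p q p' q' => by ring, fun d p q p' q' => by ring, by norm_num, ?_, ?_, fun d p q => ⟨by ring, by ring⟩⟩
  · intro q q' hq hq'
    nlinarith [mul_le_mul hq (by linarith : (7:ℤ) ≤ q + 2 * q') (by norm_num) (by linarith)]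
  · intro p p' hp hp'
    nlinarith [mul_le_mul hp' (by linarith : (7:ℤ) ≤ 2 * p + 3 * p') (by norm_num) (by linarith)]

/-- **The two wall bottoms are template-𝒞₁ instances ([XXIV] ADDENDUM 1, LEMMA WB).** `(b₀,b₁) = (3,1)`, frame `((3,−1),(1,0))`
(type I, det 1; `D(3,0)`, class `(6,−3,1)`): `u₀ = (9,−3,1)`, `u₁ = (1,0,0)`, `n = (6,−1,0)`, `v = u₀ − 3u₁ = (6,−3,1)`, `w₂ = 2u₀+2n =
(30,−8,2)`, `w₁ = 6u₁+2n = (18,−2,0)`; the exceptional pieces: `u_q = [(2,−1)²] = (4,−2,1)` and `𝔄 = n − 4u₁ = (2,−1,0)`, with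
`⟨u_q,w₂⟩ = −6` (B₂ bound 6), `⟨𝔄,w₁⟩ = 4` (B₁ bound 4), `N(𝔄) = 1`, `rk q + rk 𝔄 = rk v`, and the slope data: `c(u_q)r(v) − c(v)r(u_q) =
0` (`μ(q) = μ(R)`: the boundary — `R` strictly μ-semistable, [20] 3.5), `c(u_q)r(u₀) − c(u₀)r(u_q) = −6 < 0`, `c(𝔄)r(u₀) − c(u₀)r(𝔄) = −3 <
0`. `(b₀,b₁) = (1,1)`, frame `((1,1),(1,0))` (type II, det −1; `(1,2)`, class `(2,−1,−1)`): `u₀ = (1,1,1)`, `u₁ = (1,0,0)`, `n = (2,1,0)`,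
`v = 3u₁ − u₀ = (2,−1,−1)`, `w₂ = 6u₁+2n = (10,2,0)`, `w₁ = 2u₀+2n = (6,4,2)`; `u_q = [(0,1)²] = (0,0,1)` (a point), `𝔄 = 4u₁ − n = (2,−1,0)`,
`⟨𝔄,w₂⟩ = −4` (B₂ bound 4), `⟨u_q,w₁⟩ = −6 = −rk w₁` (B₁ bound 6), `N(𝔄) = 1`, `rk 𝔄 = rk v + rk q`, slopes `c(𝔄)r(w₂) − c(w₂)r(𝔄) =
−14 < 0`, `c(𝔄)r(w₁) − c(w₁)r(𝔄) = −14 < 0`. [shadow: `norm_num`] -/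
theorem pg11a_wall_bottoms :
    ((9:ℤ) - 3 * 1 = 6 ∧ (-3:ℤ) - 3 * 0 = -3 ∧ (1:ℤ) - 3 * 0 = 1 ∧
      2 * (9:ℤ) + 2 * 6 = 30 ∧ 2 * (-3:ℤ) + 2 * (-1) = -8 ∧ 2 * (1:ℤ) + 2 * 0 = 2 ∧
      6 * (1:ℤ) + 2 * 6 = 18 ∧ 6 * (0:ℤ) + 2 * (-1) = -2 ∧
      2 * (-2:ℤ) * (-8) - 4 * 2 - 30 * 1 = -6 ∧ 2 * (-1:ℤ) * (-2) - 2 * 0 - 18 * 0 = 4 ∧ (-1:ℤ) ^ 2 - 2 * 0 = 1 ∧ (4:ℤ) + 2 = 6 ∧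
      (-2:ℤ) * 6 - (-3) * 4 = 0 ∧ (-2:ℤ) * 9 - (-3) * 4 = -6 ∧ (-1:ℤ) * 9 - (-3) * 2 = -3) ∧
    (3 * (1:ℤ) - 1 = 2 ∧ 3 * (0:ℤ) - 1 = -1 ∧ 3 * (0:ℤ) - 1 = -1 ∧
      6 * (1:ℤ) + 2 * 2 = 10 ∧ 6 * (0:ℤ) + 2 * 1 = 2 ∧ 6 * (0:ℤ) + 2 * 0 = 0 ∧
      2 * (1:ℤ) + 2 * 2 = 6 ∧ 2 * (1:ℤ) + 2 * 1 = 4 ∧ 2 * (1:ℤ) + 2 * 0 = 2 ∧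
      4 * (1:ℤ) - 2 = 2 ∧ 4 * (0:ℤ) - 1 = -1 ∧ 4 * (0:ℤ) - 0 = 0 ∧
      2 * (-1:ℤ) * 2 - 2 * 0 - 10 * 0 = -4 ∧ 2 * (0:ℤ) * 4 - 0 * 2 - 6 * 1 = -6 ∧ (-1:ℤ) ^ 2 - 2 * 0 = 1 ∧ (2:ℤ) = 2 + 0 ∧
      (-1:ℤ) * 10 - 2 * 2 = -14 ∧ (-1:ℤ) * 6 - 4 * 2 = -14) := by
  refine ⟨by norm_num, by norm_num⟩

end ProductGroundElevenAdd1

end Summit.HodgeConjecture.HodgeConjecture.WeilTypeLadder
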